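import Literature.NumberTheory.EllipticCurves.GreenbergVatsal2000.NonPrimitiveDatumSelmerInvariants
import Literature.NumberTheory.EllipticCurves.GreenbergVatsal2000.NonPrimitiveLambdaInvariant
import Literature.NumberTheory.EllipticCurves.IwasawaTowerTorsionOrdinaryProofs
import Literature.NumberTheory.EllipticCurves.IwasawaSelmerIsTorsionProofs
import Literature.NumberTheory.EllipticCurves.IwasawaAlgebraMuAdditiveProofs
import Literature.NumberTheory.EllipticCurves.SerreOpenImageOrdinaryInertiaProofs
import Summits.BirchSwinnertonDyer.Rank1Residual.Additive.SelmerGVEqualityBadPlaces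
import Summits.BirchSwinnertonDyer.Rank1Residual.Additive.GordRamifiedOrdinaryLine
import Summits.BirchSwinnertonDyer.Rank1Residual.GaloisImage.GreenbergConditionOfStrictCondition
import Summits.BirchSwinnertonDyer.Rank1Residual.X2.GreenbergVatsalReductionDatumCard
import HarnessLib

/-!
# GV (6)–(7) at a good ORDINARY prime DERIVED: the curve-level record
# `GreenbergVatsal2000.lambda_nonPrimitive_eq_add_sum_delta` (registry A115) is a COROLLARY of the
# datum record `GreenbergVatsal2000.datumSelmer_nonPrimitive_invariants` (GV Prop. (2.1) ⇒
# Cor. (2.3) + Prop. (2.4) at the datum; T-GV23L) and `L_𝔭 ⊆ im κ_𝔭` (A111)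

HONEST FRAMING (BSD rank-`≤ 1` residual cell `b2b-bsdres`, home
`run/shared/lean/b2b/bsd-rank1-residual/`, unit `b2b-bsdres-eisenstein-p2`, class X2; research route,
no claim beyond stated classes): the cell deletes the COMBINATION-SHAPED residual classes of the
rank-`≤ 1` BSD formula from PUBLISHED theorems only and TYPES the construction-shaped ones; this is
not "finishing BSD". THEOREMS ONLY (no definition, no named fact, nothing asserted, nothing booked).

## What

The tree carried Greenberg–Vatsal's relations (6)–(7) ("`μ_{E,Σ₀} = μ_E`,
`λ_{E,Σ₀} = λ_E + Σ_{ℓ∈Σ₀} δ_E^{(ℓ)}`", §1 p. 7–8) TWICE as named facts about the CLASSICAL Selmer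
groups of an elliptic curve: `lambda_nonPrimitive_eq_add_sum_delta` (good ordinary `p`, file
`NonPrimitiveLambdaInvariant`) and its multiplicative sibling. GV prove them in §2 for a general
ordinary DATUM `(A, C)` (Prop. (2.1), Cor. (2.3), Prop. (2.4)) and specialise on p. 26 ("Assume that
`E` has good ordinary reduction at `p` … `Sel_E(ℚ_∞)_p = S_A(ℚ_∞)`. The nonprimitive Selmer groups
… also coincide … Corollary (2.3) then implies the important relationships (6) and (7)"). The datum
statement is now the tree record `datumSelmer_nonPrimitive_invariants` (team n1011's literature
seat, file `NonPrimitiveDatumSelmerInvariants`). THIS FILE performs p. 26's specialisation in the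
kernel:

* §1 `exists_datumDualData_of_eq`, `exists_datumDualData_of_selmerDualData`,
  `exists_datumDualData_of_nonPrimitiveDualData` — TRANSPORT of Pontryagin-dual data along an
  EQUALITY of Selmer groups (any number field, any Greenberg data): a dual datum `D` of `Sel_E(K_∞)_p` (resp. `DS` of `Sel^{Σ₀}_E(K_∞)_p`) and an
  equality `Sel = S_A` (resp. `Sel^{Σ₀} = S^{Σ₀}_A`) give a `DatumDualData` with the SAME
  `Λ`-module (`∃ D', Nonempty (D'.X ≃ₗ[Λ] D.X)`; no definition is introduced).
* §2 `lambda_nonPrimitive_eq_add_sum_delta_of_datum` — **A115 ⇐ T-GV23L + A111**: for `E/ℚ`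
  globally minimal, `p` odd good ordinary, `κ` cyclotomic: Greenberg's reduction datum
  `C = ker(E[p^∞] → Ẽ)` (`reductionData`) is a divisible line with `#C[p] = p`
  (`Additive.reductionDatum_divisible`, `natCard_reductionData_plus_inf_torsionBy`), `E(ℚ_∞)[p^∞]`
  is finite (`finite_fixedPoints_kerSubgroup_geomPrimaryTorsion_of_ordinary`), the classical and
  datum conditions agree at `p` modulo A111 (`localKerOver_eq_greenbergKer_and_strictKer`) and at
  EVERY `v ∤ p`, bad places included (team n1011 / p06: `Additive.selmerInfty_eq_datumSelmerInfty`,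
  `Additive.nonPrimitiveSelmerInfty_eq_datumSelmerInfty`), so `Sel_E(ℚ_∞)_p = S_A(ℚ_∞)` and
  `Sel^{Σ₀}_E(ℚ_∞)_p = S^{Σ₀}_A(ℚ_∞)` for EVERY finite `Σ₀ ∌ p`; transport the given duals (§1), read
  the datum record, transport back (`Module.Finite.equiv`, `isTorsion_of_injective`,
  `muInvariant_eq_of_linearEquiv`, `lambdaInvariant_eq_of_linearEquiv`).
* `lambda_nonPrimitive_eq_add_sum_delta_of_datum_of_strict` — the same from A239
  (`Greenberg1999.imKummer_ge_strictCondition_goodOrdinary`) through the tree's `A239 ⟹ A111`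
  (`GaloisImage/GreenbergConditionOfStrictCondition`).

Registry consequence (for lit / the referee, not asserted by Lean): A115 is DERIVED modulo
{T-GV23L, A111} (A111 itself derived from A239, `GaloisImage/GreenbergConditionOfStrictCondition`);
every consumer of `(hA : lambda_nonPrimitive_eq_add_sum_delta)` (route G `CongruentLambdaShiftDerived`,
`MuTransferDerived`, `NonPrimitiveSelmerCorank`, the Tate-free A14 chain
`GreenbergVatsalThm13GoodOrdinaryTateFree`) can be fed from these two records.

References: R. Greenberg, V. Vatsal, *On the Iwasawa invariants of elliptic curves*, Invent. Math.
142 (2000) = arXiv:math/9906215, §1 (6)–(7) pp. 7–8, §2 Prop. (2.1), Cor. (2.3), Prop. (2.4)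
pp. 17–22, p. 26; R. Greenberg, LNM 1716 (1999), §2 Props. 2.2, 2.4 (pp. 73–75), §1 p. 62, §3 p. 86.
-/

noncomputable section

open scoped Classical AddSubgroup

universe u

namespace Summit.BirchSwinnertonDyer.Rank1Residual.X2.NonPrimitiveLambdaInvariantOfDatum

open NumberField IsDedekindDomain Field WeierstrassCurve
  Literature.NumberTheory.EllipticCurves Literature.NumberTheory.EllipticCurves.GreenbergSelmer
  Literature.NumberTheory.EllipticCurves.GreenbergVatsal2000
  Literature.NumberTheory.GaloisRepresentations
  Summit.BirchSwinnertonDyer.Rank1Residual.X2.GreenbergVatsalReductionDatum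
  Summit.BirchSwinnertonDyer.Rank1Residual.X2.GreenbergVatsalStrictAtP

/-! ## §1. Transport of Pontryagin-dual data along an equality of Selmer groups -/

section Transport

variable {K : Type u} [Field K] [NumberField K] {p : ℕ} [Fact p.Prime] (κ : ZpExtension K p)
  (γ : absoluteGaloisGroup K) (M : Type u) [AddCommGroup M]
  [DistribMulAction (absoluteGaloisGroup K) M] [TopologicalSpace M] [DiscreteTopology M]
  (L : Data K M p) (S₀ : Set (HeightOneSpectrum (𝓞 K)))

/-- **Transport of Pontryagin-dual data along an equality of subgroups** (generic form): if GV's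
datum Selmer group `S^{S₀}_M(K_∞)` EQUALS a subgroup `S ⊆ H¹(K_∞, M)` for which dual data in the
tree's shape are given (a `Λ`-module `X`, a bijection `toDual : X ≅ Hom(S, ℚ/ℤ)`, `T = conj_γ − 1`,
constants through `ℤ_p → ℤ/p^k`), then the SAME `X` carries a `DatumDualData κ γ M L S₀` — after
`subst` the fields are the given ones verbatim (the membership proofs inside `⟨conj_γ s, _⟩` are
irrelevant). Stated as `∃ D', Nonempty (D'.X ≃ₗ[Λ] X)` so that no definition is introduced.
[cite: GreenbergVatsal2000, §2 p. 17 (the `Λ`-module structure)] -/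
theorem exists_datumDualData_of_eq {S : AddSubgroup (subgroupH1 κ.kerSubgroup M)}
    (hS : datumSelmerInfty κ M L S₀ = S) (X : Type u) [AddCommGroup X]
    [Module (IwasawaAlgebra p) X] (conj_mem : ∀ s ∈ S, conjH1 κ.kerSubgroup M γ s ∈ S)
    (toDual : X →+ (S →+ AddCircle (1 : ℚ))) (bij : Function.Bijective toDual)
    (hT : ∀ (x : X) (s : S), toDual ((PowerSeries.X : IwasawaAlgebra p) • x) s =
      toDual x ⟨conjH1 κ.kerSubgroup M γ s, conj_mem s s.2⟩ - toDual x s)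
    (hC : ∀ (c : ℤ_[p]) (x : X) (s : S) (k : ℕ), (p ^ k) • s = 0 →
      toDual (PowerSeries.C c • x) s = (PadicInt.toZModPow k c).val • toDual x s) :
    ∃ D' : DatumDualData κ γ M L S₀, Nonempty (D'.X ≃ₗ[IwasawaAlgebra p] X) := by
  subst hS
  exact ⟨{ X := X, toDual := toDual, bijective := bij, toDual_T_smul := hT, toDual_C_smul := hC },
    ⟨LinearEquiv.refl _ _⟩⟩

variable {κ γ L S₀} (W : WeierstrassCurve K)

/-- **Transport, primitive side.** A Pontryagin-dual datum `D` of the classical `Sel_E(K_∞)_p`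
together with an equality of subgroups `Sel_E(K_∞)_p = S_A(K_∞)` (`A = E[p^∞]`, Greenberg data `L`,
`Σ₀ = ∅`) yields a dual datum of `S_A(K_∞)` in GV's sense (`DatumDualData … L ∅`) whose `Λ`-module
IS `D.X`. GV p. 26: "`Sel_E(ℚ_∞)_p = S_A(ℚ_∞)`". [cite: GreenbergVatsal2000, §2 pp. 17, 26] -/
theorem exists_datumDualData_of_selmerDualData {L : Data K (W.geomPrimaryTorsion p) p}
    (D : W.SelmerDualData κ γ)
    (h : W.selmerInfty κ = datumSelmerInfty κ (W.geomPrimaryTorsion p) L ∅) :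
    ∃ D' : DatumDualData κ γ (W.geomPrimaryTorsion p) L (∅ : Set (HeightOneSpectrum (𝓞 K))),
      Nonempty (D'.X ≃ₗ[IwasawaAlgebra p] D.X) :=
  exists_datumDualData_of_eq κ γ (W.geomPrimaryTorsion p) L ∅ h.symm D.X D.conj_mem D.toDual
    D.bijective D.toDual_T_smul D.toDual_C_smul

/-- **Transport, non-primitive side.** A Pontryagin-dual datum `DS` of GV's printed non-primitive
group `Sel^{Σ₀}_E(K_∞)_p` (`NonPrimitiveDualData`) together with an equality
`Sel^{Σ₀}_E(K_∞)_p = S^{Σ₀}_A(K_∞)` yields a dual datum of `S^{Σ₀}_A(K_∞)` (`DatumDualData … L Σ₀`)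
whose `Λ`-module IS `DS.X`. GV p. 26: "The nonprimitive Selmer groups `Sel^{Σ₀}_E(ℚ_∞)_p` and
`S^{Σ₀}_A(ℚ_∞)` also coincide". [cite: GreenbergVatsal2000, §2 pp. 17, 20, 26] -/
theorem exists_datumDualData_of_nonPrimitiveDualData {L : Data K (W.geomPrimaryTorsion p) p}
    {S₀ : Set (HeightOneSpectrum (𝓞 K))} (DS : NonPrimitiveDualData W κ γ S₀)
    (h : nonPrimitiveSelmerInfty W κ S₀ = datumSelmerInfty κ (W.geomPrimaryTorsion p) L S₀) :
    ∃ D' : DatumDualData κ γ (W.geomPrimaryTorsion p) L S₀,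
      Nonempty (D'.X ≃ₗ[IwasawaAlgebra p] DS.X) :=
  exists_datumDualData_of_eq κ γ (W.geomPrimaryTorsion p) L S₀ h.symm DS.X DS.conj_mem DS.toDual
    DS.bijective DS.toDual_T_smul DS.toDual_C_smul

end Transport

/-! ## §2. A115 from the datum record (GV p. 26's specialisation, in the kernel) -/

section GoodOrdinary

/-- **GV (6)–(7) at a good ordinary prime, DERIVED** (registry A115 ⇐ T-GV23L + A111). GV p. 26:
"Assume that `E` has good ordinary reduction at `p`. … `Sel_E(ℚ_∞)_p = S_A(ℚ_∞)`. The nonprimitive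
Selmer groups `Sel^{Σ₀}_E(ℚ_∞)_p` and `S^{Σ₀}_A(ℚ_∞)` also coincide … By Kato's theorem, `S_A(ℚ_∞)` is
`Λ`-cotorsion. Also, `H⁰(ℚ_∞, A*)` is finite since `A* ≅ E[p^∞]` by the Weil pairing and
`E(ℚ_∞)_{tors}` is known to be finite. … Corollary (2.3) then implies the important relationships (6)
and (7)." Inputs: the datum record `datumSelmer_nonPrimitive_invariants` (`h23`) and
`imKummer_ge_greenbergCondition_at_p` (`hGV`, the printed `L_𝔭 ⊆ im κ_𝔭`); everything else is a
tree theorem (module docstring). [cite: GreenbergVatsal2000, §1 (6)–(7) pp. 7–8; §2 Cor. (2.3), Prop. (2.4) (pp. 20–22); p. 26]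
[cite: GreenbergLNM1716, §2 Props. 2.2, 2.4 (pp. 73–75); §3 p. 86] -/
theorem lambda_nonPrimitive_eq_add_sum_delta_of_datum (h23 : datumSelmer_nonPrimitive_invariants)
    (hGV : imKummer_ge_greenbergCondition_at_p) : lambda_nonPrimitive_eq_add_sum_delta := by
  intro W _ _ p _ hp2 hgood hord κ hκ γ hγ S₀ hS₀ D _ DS hX
  have hΔ : ¬ (p : ℤ) ∣ minimalDiscriminantInt W :=
    W.not_dvd_minimalDiscriminantInt_of_hasGoodReductionAtPrime' p hgood
  -- Greenberg's reduction data above `p` and its three properties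
  have hRD : ∀ (v : HeightOneSpectrum (𝓞 ℚ)) (hv : ((p : ℕ) : 𝓞 ℚ) ∈ v.asIdeal),
      (reductionData W p hΔ v hv).greenbergKer κ.kerSubgroup =
        W.localKerOver p κ.kerSubgroup (v.adicCompletion ℚ) :=
    fun v hv ↦ (localKerOver_eq_greenbergKer_and_strictKer W p κ hGV hκ hv hΔ hord).1.symm
  have hC : ∀ (v : HeightOneSpectrum (𝓞 ℚ)) (hv : ((p : ℕ) : 𝓞 ℚ) ∈ v.asIdeal),
      (∀ c ∈ (reductionData W p hΔ v hv).plus, ∃ c' ∈ (reductionData W p hΔ v hv).plus, p • c' = c) ∧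
        Nat.card ↥((reductionData W p hΔ v hv).plus ⊓ (↥(W.geomPrimaryTorsion p))[(p : ℤ)]) = p :=
    fun v hv ↦ ⟨Additive.reductionDatum_divisible W p hv hΔ hord,
      natCard_reductionData_plus_inf_torsionBy W p hΔ hord v hv⟩
  have hA : Finite (FixedPoints.addSubgroup κ.kerSubgroup (W.geomPrimaryTorsion p)) :=
    W.finite_fixedPoints_kerSubgroup_geomPrimaryTorsion_of_ordinary κ hp2 hgood hord hκ
  -- classical = datum, primitive and non-primitive (bad places outside `Σ₀` allowed)
  have hSel : W.selmerInfty κ = datumSelmerInfty κ (W.geomPrimaryTorsion p) (reductionData W p hΔ) ∅ :=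
    Additive.selmerInfty_eq_datumSelmerInfty W p κ hp2 hκ (reductionData W p hΔ) hRD
  have hNP : nonPrimitiveSelmerInfty W κ (↑S₀ : Set (HeightOneSpectrum (𝓞 ℚ))) =
      datumSelmerInfty κ (W.geomPrimaryTorsion p) (reductionData W p hΔ)
        (↑S₀ : Set (HeightOneSpectrum (𝓞 ℚ))) :=
    Additive.nonPrimitiveSelmerInfty_eq_datumSelmerInfty W p κ _ hp2 hκ (reductionData W p hΔ) hRD
      (fun v hv ↦ hS₀ v (Finset.mem_coe.1 hv))
  -- transport the duals
  obtain ⟨X, ⟨eX⟩⟩ := exists_datumDualData_of_selmerDualData W D hSel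
  obtain ⟨X₀, ⟨eX₀⟩⟩ := exists_datumDualData_of_nonPrimitiveDualData W DS hNP
  haveI : Module.Finite (IwasawaAlgebra p) X.X := Module.Finite.equiv eX.symm
  have hXt : Module.IsTorsion (IwasawaAlgebra p) X.X :=
    isTorsion_of_injective eX.toLinearMap eX.injective hX
  -- the datum record
  obtain ⟨hfg, htors, hμ, hlam, -⟩ := h23 W p hp2 κ hκ γ hγ (reductionData W p hΔ) hC hA S₀ hS₀ X X₀ hXt
  haveI := hfg
  refine ⟨Module.Finite.equiv eX₀, isTorsion_of_injective eX₀.symm.toLinearMap eX₀.symm.injective htors,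
    ?_, ?_⟩
  · rw [← muInvariant_eq_of_linearEquiv eX₀, hμ, muInvariant_eq_of_linearEquiv eX]
  · rw [← lambdaInvariant_eq_of_linearEquiv eX₀, hlam, lambdaInvariant_eq_of_linearEquiv eX]

/-- **A115 from T-GV23L and A239** (`Greenberg1999.imKummer_ge_strictCondition_goodOrdinary`, the
strict finite-layer form of Greenberg's Prop. 2.4), through the tree's composition A239 ⟹ A111
(`GaloisImage.GreenbergConditionOfStrictCondition.imKummer_ge_greenbergCondition_at_p_of_strict`).
[cite: GreenbergVatsal2000, §1 (6)–(7) pp. 7–8; §2 p. 26]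
[cite: GreenbergLNM1716, §2 Props. 2.2, 2.4 (pp. 73–75)] -/
theorem lambda_nonPrimitive_eq_add_sum_delta_of_datum_of_strict
    (h23 : datumSelmer_nonPrimitive_invariants)
    (h239 : Greenberg1999.imKummer_ge_strictCondition_goodOrdinary) :
    lambda_nonPrimitive_eq_add_sum_delta :=
  lambda_nonPrimitive_eq_add_sum_delta_of_datum h23
    (GaloisImage.GreenbergConditionOfStrictCondition.imKummer_ge_greenbergCondition_at_p_of_strict h239)

end GoodOrdinary

end Summit.BirchSwinnertonDyer.Rank1Residual.X2.NonPrimitiveLambdaInvariantOfDatum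

end
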